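/-
Copyright (c) 2026 the pub-hodgecm-mathlib formalisation cell (harness21).  Prover seat hodgecm-mathlib-LH4-p12 (g4), Track A «(D-RAM) FOUR-FRAME», unit U2H, the census leaf
(ρ2b′-X) `stub_U2H_fixedPointCensus_typeTwo_unit0` — plan-owner memo T5-FRAME v1 §1, organ F3: the census conditions on the line `K♮·ϖ^j·(α − ρα)`.  2026-09-04.
-/
import Literature.NumberTheory.LocalFields.QuadraticOrderHermitianDual   -- ★ p857067 (T4c) → ★ p857040 (T4 II) → ★ p857021 (T4 I): orders `𝒪^ρ + c𝒪`, Euler ∕ hermitian duals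
import HarnessLib

/-!
# The census conditions for a dual parameter `y = k·c·(α − ρα)` with `ρ(α − ρα) = −(α − ρα)`: integrality `⟺ |y| ≤ 1 ∧ |k + ρk| ≤ 1`, the norm
# `y·ρy = −kρ(k)·c²(α − ρα)²`, and the depth condition `μ∕y ∈ 𝒪^ρ + c𝒪 ⟺ |μ| ≤ |y| ∧ |μρ(k) + ρ(μ)k| ≤ |kρ(k)|·|c(α − ρα)|²`
(Serre, *Local Fields* Ch. III §6 Prop. 11–12, Ch. V §3; Jacobowitz 1962 §4)

Topic `NumberTheory/LocalFields`; namespace `Literature.NumberTheory.LocalFields.QuadraticOrder` (= ★ T4 parts I–III p857021 ∕ p857040 ∕ p857067).  THEOREMS ONLY (no definition,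
no instance, no notation, no named fact, no `sorry`); kernel lane `--supports stmt-HodgeConjecture-24833` (count-neutral).  Cell `pub/hodgecm-mathlib` (D-0151), crux H413, Track A
«(D-RAM) FOUR-FRAME», unit U2H.  WHY: in the toric ∕ order reduction of the WILD type-(2) fixed-point census (ρ2b′-X) (LH4-p12 (g3) PAYER-PLAN-rho2bX v2; LH4-p14 (g3) payer of
record) a `λ`-stable plane lattice is `Λ = x·𝒪_j` (★ Mars, part II) with hermitian dual `Λ^# = y⁻¹Λ`, `y = h·xΘ(x)·ϖ_E^j·(α − ρα)` (★ part III), and `k := h·xΘ(x)` lies in the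
THIRD quadratic field `K♮ = M^Θ`, on which `ρ` acts as the conjugation of `K♮∕F`.  THIS FILE (plan-owner memo `T5-FRAME-Knatural.v1` §1, organ F3) turns the three census
conditions — `Λ` integral and Gram-primitive, its discriminant length, and the DEPTH CONDITION `(λ − u)Λ^# ⊆ Λ` — into conditions on `k` through `k + ρk` (`= Tr_{K♮∕F} k`),
`k·ρk` (`= N_{K♮∕F} k`) and the trace pairing `μρ(k) + ρ(μ)k` (`= Tr_{M∕E}(μ·ρk)`) with `μ = λ − u`; the census thereby becomes a sum over `k`-classes in `K♮ˣ` (memo §2).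
The identities hold for ANY `k ∈ M` (only `ρ(α − ρα) = −(α − ρα)` and `ρ c = c` are used), so no `Θ` appears here.

CURRENCY: as parts I–III — one field `K` (model of `M`) with `Valued K ℤᵐ⁰`, `ρ : K →+* K` with `ρρ = id` (and `|ρ x| = |x|` where needed), `α` with `ρα ≠ α`; the order of
conductor `c` (`ρ c = c`, `0 < |c| ≤ 1`) is the spelled-out predicate `|z| ≤ 1 ∧ |z − ρz| ≤ |c(α − ρα)|`.

* §1 ALGEBRA of the anti-line: `ρ(α − ρα) = −(α − ρα)`; for `y = k·(c(α − ρα))`: `y − ρy = (k + ρk)·(c(α − ρα))`, `y·ρy = −(kρk)·(c(α − ρα))²`,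
  `μ∕y − ρ(μ∕y) = (μρk + ρ(μ)k) ∕ (kρk·c(α − ρα))`; and the trace split `μρk + ρ(μ)k = (m₁ρk + ρ(m₁)k) + (m₂ρk + ρ(m₂)k)·s` for `μ = m₁ + m₂s`, `ρs = s`.
* §2 (P) **`mul_line_mem_order_iff`**: `k·c(α − ρα)` lies in the order of conductor `c` iff `|k·c(α − ρα)| ≤ 1 ∧ |k + ρk| ≤ 1`; the GRAM-PRIMITIVITY test
  `mul_line_div_mem_order_iff` (the same for `y∕e`, `e` fixed nonzero: `⟺ |y| ≤ |e| ∧ |k + ρk| ≤ |e|`).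
* §3 (D) **`div_mul_line_mem_order_iff`**: `μ∕y` lies in the order of conductor `c` iff `|μ| ≤ |y| ∧ |μρk + ρ(μ)k| ≤ |kρk|·|c(α − ρα)|²` (`k ≠ 0`).
HONEST LABEL: HC_CM is proved only modulo the 7 printed citations (2 remaining named inputs: hLiu418 = stmt-HodgeConjecture-24832, h413 = stmt-HodgeConjecture-24833) until rung 0
closes; unconditional local algebra, count-neutral (organ F3 of the (ρ2b′-X) payer frame; the fibre count `t_j = [T : T ∩ 𝒪_jˣ]`, the side ∕ coset statement and the per-type
`k`-sums (F1, F2, F4) are separate files).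

## References
* [Serre1979] J.-P. Serre, *Local Fields*, GTM 67 (1979): Ch. III §6 Prop. 11–12 (power bases, codifferent), Ch. V §3 (norm and trace of a cyclic extension of prime degree).
* [Jacobowitz1962] R. Jacobowitz, *Hermitian forms over local fields*, Amer. J. Math. 84 (1962): §4 (duals, scales, norms of hermitian lattices; modular lattices).
-/

set_option autoImplicit false

open WithZero

namespace Literature.NumberTheory.LocalFields.QuadraticOrder

/-! ## §1 Algebra of the anti-line `k·c(α − ρα)` -/

section Algebra

variable {K : Type*} [Field K] {ρ : K →+* K}

/-- `α − ρα` is ANTI-fixed: `ρ(α − ρα) = −(α − ρα)` (`ρρ = id`). [cite: Serre1979, Ch. III §6 Prop. 12] -/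
theorem map_sub_map_eq_neg (hρρ : ∀ x, ρ (ρ x) = x) (α : K) : ρ (α - ρ α) = -(α - ρ α) := by
  rw [map_sub, hρρ]; ring

/-- For `y = k·(c(α − ρα))` with `c` fixed: **`y − ρy = (k + ρk)·(c(α − ρα))`** (the anti-fixed part of `y` is the TRACE of `k` times the line generator). [cite: Serre1979, Ch. V §3] -/
theorem mul_line_sub_map (hρρ : ∀ x, ρ (ρ x) = x) (α : K) {c : K} (hc : ρ c = c) (k : K) :
    k * (c * (α - ρ α)) - ρ (k * (c * (α - ρ α))) = (k + ρ k) * (c * (α - ρ α)) := by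
  rw [map_mul, map_mul, hc, map_sub_map_eq_neg hρρ]; ring

/-- For `y = k·(c(α − ρα))` with `c` fixed: **`y·ρy = −(k·ρk)·(c(α − ρα))²`** (so `ord_E N_{M∕E}(y) = ord_E N(k) + 2·ord_E(c(α − ρα))`: the discriminant length `2a`).
[cite: Serre1979, Ch. V §3] -/
theorem mul_line_mul_map (hρρ : ∀ x, ρ (ρ x) = x) (α : K) {c : K} (hc : ρ c = c) (k : K) :
    k * (c * (α - ρ α)) * ρ (k * (c * (α - ρ α))) = -(k * ρ k) * (c * (α - ρ α)) ^ 2 := by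
  rw [map_mul, map_mul, hc, map_sub_map_eq_neg hρρ]; ring

/-- For `y = k·(c(α − ρα))` (`c` fixed, `k, c, α − ρα ≠ 0`): **`μ∕y − ρ(μ∕y) = (μρk + ρ(μ)k) ∕ ((kρk)·(c(α − ρα)))`** — the anti-fixed part of `μ∕y` is the TRACE PAIRING
`Tr_{M∕E}(μρk)` over `N(k)` times the line generator. [cite: Serre1979, Ch. V §3] -/
theorem div_mul_line_sub_map (hρρ : ∀ x, ρ (ρ x) = x) {α : K} (hα : ρ α ≠ α) {c : K} (hc : ρ c = c) (hc0 : c ≠ 0) {k : K} (hk : k ≠ 0) (μ : K) :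
    μ / (k * (c * (α - ρ α))) - ρ (μ / (k * (c * (α - ρ α)))) = (μ * ρ k + ρ μ * k) / ((k * ρ k) * (c * (α - ρ α))) := by
  have hd : α - ρ α ≠ 0 := sub_ne_zero.2 (Ne.symm hα)
  have hρk : ρ k ≠ 0 := (map_ne_zero ρ).2 hk
  rw [map_div₀, map_mul, map_mul, hc, map_sub_map_eq_neg hρρ]
  field_simp
  ring

/-- TRACE SPLIT along `μ = m₁ + m₂·s` with `s` fixed (`s = √θ ∈ E` in the census, `m_i ∈ K♮`): `μρk + ρ(μ)k = (m₁ρk + ρ(m₁)k) + (m₂ρk + ρ(m₂)k)·s` — the two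
`F`-bilinear trace pairings `Tr_{K♮∕F}(m_i k̄)` of the depth condition. [cite: Serre1979, Ch. V §3] -/
theorem trace_pairing_split {s : K} (hs : ρ s = s) (m₁ m₂ k : K) :
    (m₁ + m₂ * s) * ρ k + ρ (m₁ + m₂ * s) * k = (m₁ * ρ k + ρ m₁ * k) + (m₂ * ρ k + ρ m₂ * k) * s := by
  rw [map_add, map_mul, hs]; ring

/-- The trace `k + ρk` and the norm `k·ρk` are fixed (`ρρ = id`). [cite: Serre1979, Ch. V §3] -/
theorem map_add_map_self (hρρ : ∀ x, ρ (ρ x) = x) (k : K) : ρ (k + ρ k) = k + ρ k := by rw [map_add, hρρ, add_comm]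

/-- The norm `k·ρk` is fixed (`ρρ = id`). [cite: Serre1979, Ch. V §3] -/
theorem map_mul_map_self (hρρ : ∀ x, ρ (ρ x) = x) (k : K) : ρ (k * ρ k) = k * ρ k := by rw [map_mul, hρρ, mul_comm]

/-- The trace pairing `μρk + ρ(μ)k` is fixed (`ρρ = id`). [cite: Serre1979, Ch. V §3] -/
theorem map_trace_pairing (hρρ : ∀ x, ρ (ρ x) = x) (μ k : K) : ρ (μ * ρ k + ρ μ * k) = μ * ρ k + ρ μ * k := by
  rw [map_add, map_mul, map_mul, hρρ, hρρ]; ring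

end Algebra

/-! ## §2 (P) Integrality and Gram-primitivity of `y = k·c(α − ρα)` in terms of the trace `k + ρk` -/

section Integrality

variable {K : Type*} [Field K] [Valued K ℤᵐ⁰] {ρ : K →+* K} {α : K}

/-- **(P) INTEGRALITY ON THE ANTI-LINE**: `y = k·(c(α − ρα))` lies in the order of conductor `c` iff `|y| ≤ 1 ∧ |k + ρk| ≤ 1` (`y − ρy = (k + ρk)·c(α − ρα)`, cancel the
nonzero `|c(α − ρα)|`).  In the census: `Λ = x𝒪_j` is INTEGRAL iff `|y| ≤ 1` and `Tr_{K♮∕F}(h·xΘx) ∈ 𝒪_F`. [cite: Jacobowitz1962, §4] [cite: Serre1979, Ch. III §6 Prop. 12] -/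
theorem mul_line_mem_order_iff (hρρ : ∀ x, ρ (ρ x) = x) (hα : ρ α ≠ α) {c : K} (hc : ρ c = c) (hc0 : c ≠ 0) (k : K) :
    (Valued.v (k * (c * (α - ρ α))) ≤ 1 ∧ Valued.v (k * (c * (α - ρ α)) - ρ (k * (c * (α - ρ α)))) ≤ Valued.v (c * (α - ρ α))) ↔
      (Valued.v (k * (c * (α - ρ α))) ≤ 1 ∧ Valued.v (k + ρ k) ≤ 1) := by
  have hcd : c * (α - ρ α) ≠ 0 := mul_ne_zero hc0 (sub_ne_zero.2 (Ne.symm hα))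
  have hv0 : Valued.v (c * (α - ρ α)) ≠ 0 := (Valuation.ne_zero_iff _).2 hcd
  have hpos : 0 < Valued.v (c * (α - ρ α)) := zero_lt_iff.2 hv0
  rw [mul_line_sub_map hρρ α hc k]
  refine and_congr Iff.rfl ⟨fun h => ?_, fun h => ?_⟩
  · rw [map_mul] at h
    have h' : Valued.v (c * (α - ρ α)) * Valued.v (k + ρ k) ≤ Valued.v (c * (α - ρ α)) * 1 := by rwa [mul_one, mul_comm]
    exact le_of_mul_le_mul_left h' hpos
  · rw [map_mul]
    calc Valued.v (k + ρ k) * Valued.v (c * (α - ρ α)) ≤ 1 * Valued.v (c * (α - ρ α)) := mul_le_mul' h le_rfl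
      _ = Valued.v (c * (α - ρ α)) := one_mul _

/-- **(P′) THE SCALED TEST `y∕e`** (`e` fixed, nonzero; Gram-primitivity is the FAILURE of this at `e = ϖ_E`): `y∕e = (k∕e)·c(α − ρα)` lies in the order of conductor `c` iff
`|y| ≤ |e| ∧ |k + ρk| ≤ |e|`. [cite: Jacobowitz1962, §4] -/
theorem mul_line_div_mem_order_iff (hρρ : ∀ x, ρ (ρ x) = x) (hα : ρ α ≠ α) {c : K} (hc : ρ c = c) (hc0 : c ≠ 0) {e : K} (he : ρ e = e) (he0 : e ≠ 0) (k : K) :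
    (Valued.v (k * (c * (α - ρ α)) / e) ≤ 1 ∧ Valued.v (k * (c * (α - ρ α)) / e - ρ (k * (c * (α - ρ α)) / e)) ≤ Valued.v (c * (α - ρ α))) ↔
      (Valued.v (k * (c * (α - ρ α))) ≤ Valued.v e ∧ Valued.v (k + ρ k) ≤ Valued.v e) := by
  have hve0 : Valued.v e ≠ 0 := (Valuation.ne_zero_iff _).2 he0
  have hve : 0 < Valued.v e := zero_lt_iff.2 hve0
  have hrew : k * (c * (α - ρ α)) / e = (k / e) * (c * (α - ρ α)) := by rw [div_mul_eq_mul_div]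
  rw [hrew, mul_line_mem_order_iff hρρ hα hc hc0 (k / e), ← hrew]
  have htr : k / e + ρ (k / e) = (k + ρ k) / e := by rw [map_div₀, he, add_div]
  rw [htr, map_div₀, map_div₀, div_le_one₀ hve, div_le_one₀ hve]

end Integrality

/-! ## §3 (D) The depth condition `μ∕y ∈ 𝒪^ρ + c𝒪` in terms of the trace pairing `μρk + ρ(μ)k` -/

section Depth

variable {K : Type*} [Field K] [Valued K ℤᵐ⁰] {ρ : K →+* K} {α : K}

/-- **(D) THE DEPTH CONDITION ON THE ANTI-LINE**: for `y = k·c(α − ρα)` (`k ≠ 0`), `μ∕y` lies in the order of conductor `c` iff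
`|μ| ≤ |y| ∧ |μρk + ρ(μ)k| ≤ |kρk|·|c(α − ρα)|²` (the anti-fixed part of `μ∕y` is `(μρk + ρ(μ)k)∕(kρk·c(α − ρα))`).  In the census (★ `forall_dual_mul_mem_iff`): the DEPTH
CONDITION `(λ − u)Λ^# ⊆ Λ` for `Λ = x𝒪_j` reads `|λ − u| ≤ |y| ∧ |Tr_{M∕E}((λ − u)·ρk)| ≤ |N_{K♮∕F} k|·|ϖ_E^j(α − ρα)|²`, `k = h·xΘx`. [cite: Jacobowitz1962, §4] [cite: Serre1979, Ch. V §3] -/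
theorem div_mul_line_mem_order_iff (hρρ : ∀ x, ρ (ρ x) = x) (hα : ρ α ≠ α) {c : K} (hc : ρ c = c) (hc0 : c ≠ 0)
    {k : K} (hk : k ≠ 0) (μ : K) :
    (Valued.v (μ / (k * (c * (α - ρ α)))) ≤ 1 ∧
        Valued.v (μ / (k * (c * (α - ρ α))) - ρ (μ / (k * (c * (α - ρ α))))) ≤ Valued.v (c * (α - ρ α))) ↔
      (Valued.v μ ≤ Valued.v (k * (c * (α - ρ α))) ∧ Valued.v (μ * ρ k + ρ μ * k) ≤ Valued.v (k * ρ k) * Valued.v (c * (α - ρ α)) ^ 2) := by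
  have hd : α - ρ α ≠ 0 := sub_ne_zero.2 (Ne.symm hα)
  have hcd : c * (α - ρ α) ≠ 0 := mul_ne_zero hc0 hd
  have hy0 : k * (c * (α - ρ α)) ≠ 0 := mul_ne_zero hk hcd
  have hρk : ρ k ≠ 0 := (map_ne_zero ρ).2 hk
  have hN0 : k * ρ k ≠ 0 := mul_ne_zero hk hρk
  have hvy : 0 < Valued.v (k * (c * (α - ρ α))) := zero_lt_iff.2 ((Valuation.ne_zero_iff _).2 hy0)
  have hvD : 0 < Valued.v (k * ρ k * (c * (α - ρ α))) := zero_lt_iff.2 ((Valuation.ne_zero_iff _).2 (mul_ne_zero hN0 hcd))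
  refine and_congr ?_ ?_
  · rw [map_div₀, div_le_one₀ hvy]
  · rw [div_mul_line_sub_map hρρ hα hc hc0 hk μ, map_div₀, div_le_iff₀ hvD]
    have hrhs : Valued.v (c * (α - ρ α)) * Valued.v (k * ρ k * (c * (α - ρ α))) = Valued.v (k * ρ k) * Valued.v (c * (α - ρ α)) ^ 2 := by
      rw [map_mul Valued.v (k * ρ k) (c * (α - ρ α)), mul_left_comm, sq]
    rw [hrhs]

end Depth

end Literature.NumberTheory.LocalFields.QuadraticOrder
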